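import Mathlib
import Literature.Probability.LatticeModels.ClusterExpansion

/-!
# Dimock, *The renormalization group according to Balaban* I, Appendix B (cluster expansion), proof of THEOREM
# `\label{cluster}`, STEP 1 — the MAYER EXPANSION `exp(Σ_X H(X)) = Π_X((e^{H(X)} − 1) + 1) = Σ_{{X_i}} Π_i(e^{H(X_i)} − 1)
# = Σ_{{Y_j}} Π_j K(Y_j)`: the regrouping of collections of polymers into disjoint connected clusters — PROVED as finite
# combinatorics (any polymer type, any symmetric overlap relation, any commutative semiring of weights); (v1.1) STEP 3 —
# the regrouped sum is the partition function of a hard-core gas of the unions, exponentiated `= exp(Σ_Y H^#(Y))` by the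
# tree's Kotecký–Preiss theorem

**Citation header (reproduction of PUBLISHED work; template of the Bałaban lattice Yang–Mills cell).**
J. Dimock, *The renormalization group according to Balaban I. Small fields*, Rev. Math. Phys. **25** (2013) 1330010
(= arXiv:1108.1335v2) [Dimock2013], Appendix B "cluster expansion" TeX L3161–3225: the setting L3167–3175, THEOREM
`\label{cluster}` (#27 of the shared counter) L3178–3194, proof step 1 L3204–3225 (the Mayer expansion and the
definition of `K(Y)`), step 2 L3284–3297, step 3 L3299–3394 (the exponentiation, eq. (hstar) L3305–3315), step 4
L3399–3506 (convergence).  The same expansion opens [Dimock2014] = part III (arXiv:1304.0705v1) §3.1 "rearrangement"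
L1421–1447 (*"We start by making some Mayer expansions … = Π_{X⊂Λ_{N+1}}(𝓘(X) + 1) = Σ_{{X_α}} Π_α 𝓘(X_α) … the sum is
now over collections of distinct {X_α}"*).  TeX line numbers refer to the arXiv sources held by the cell
(`inputs/files/dimock/src/1108.1335/1108.1335.tex`, `…/1304.0705/1304.0705.tex`); every quotation below was read there
this session.  Dimock's papers are published and refereed and are the cell's TEMPLATE, not manuscripts under audit;
no quantity of the Bałaban series is touched.  Dimock on provenance (L3163–3164): *"We give a treatment of the standard
cluster expansion adapted to our circumstances. General references are [Cam82], [Sei82], [Bry86], [GlJa87]. We present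
an ultralocal version favored by Balaban."*

**What the paper prints (verbatim, L3204–3225).**  *"step 1: Start with a Mayer expansion which yields exp(Σ_X H(X, Φ))
= Π_X((e^{H(X,Φ)} − 1) + 1) = Σ_{{X_i}} Π_i (e^{H(X_i,Φ)} − 1) = Σ_{{Y_j}} Π_j K(Y_j, Φ)  Here the product over X is
written as a sum over collections of distinct polymers {X_i}. Then terms in this sum are grouped together into
collections of disjoint polymers {Y_j} (possibly empty), defining for connected Y  K(Y, Φ) = Σ_{{X_i}: ∪X_i = Y} Π_i
(e^{H(X_i,Φ)} − 1)  In this sum we require that the {X_i} cannot be divided into two disjoint sets. Instead of unordered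
{X_i} we can write this as a sum over ordered sets (X_1, …, X_n) by K(Y, Φ) = Σ_{n=1}^∞ (1/n!) Σ_{(X_1,⋯X_n): ∪_iX_i = Y}
Π_i (e^{H(X_i,Φ)} − 1) still with the same conditions on the X_i."*

**What is reproduced here (kernel-checked, zero `sorry`; Mathlib only).**  Pure finite combinatorics: a type `P` of
polymers, a finite set `Pol : Finset P` of them (print: the `M`-polymers `X` of the torus), a symmetric OVERLAP relation
`ov` (§§1–2) — in §3 the overlap of supports `supp : P → Finset C` in a type `C` of cubes (print: `X ∩ X′ ≠ ∅`) — and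
weights in any commutative (semi)ring `R` (print: `a_X = e^{H(X,Φ)} − 1 ∈ ℝ` or `ℂ` at fixed `Φ`).
* §1 CONNECTED SUB-COLLECTIONS: `Linked ov S X Y` (a chain of members of `S`, consecutive ones overlapping), the component
  `comp ov S X`, `components ov S`, `IsConnColl ov S` (nonempty, all members linked) with **`isConnColl_iff_noSplit`** (=
  Dimock's *"cannot be divided into two disjoint sets"*), `Separated ov T T′`; PROVED: the components exhaust `S`
  (`biUnion_components`), are pairwise disjoint (`pairwiseDisjoint_components`), connected (`isConnColl_comp`) and
  pairwise separated (`separated_of_mem_components`).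
* §2 THE REGROUPING INTO CLUSTERS: `admissible ov Pol` = the families of pairwise separated connected sub-collections;
  **`components_biUnion_of_admissible`** (`components(⋃𝒯) = 𝒯`); **`sum_powerset_prod_components`**: `Σ_{S⊆Pol} Π_{T ∈
  components S} g(T) = Σ_{𝒯 admissible} Π_{T∈𝒯} g(T)` (the bijection `S ↦ components S`, inverse `⋃`);
  `prod_eq_prod_components`; **`prod_one_add_eq_sum_admissible`**: `Π_{X∈Pol}(1 + a_X) = Σ_{𝒯 admissible} Π_{T∈𝒯}Π_{X∈T}
  a_X` — lines 1–3 of step 1 with the clusters recorded as sub-collections `{X_i}`.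
* §3 GROUPING BY UNIONS (Dimock's `K(Y)`): `Overlap supp`, `U supp T = ⋃_{X∈T} supp X`, `covers supp Pol Y` (connected
  `{X_i} ⊆ Pol` with `∪X_i = Y`), **`K supp Pol g Y = Σ_{T ∈ covers Y} g(T)`**, `famD supp Pol` (families `{Y_j}` of
  pairwise disjoint nonempty unions); `disjoint_U_iff` (disjoint unions ⟺ separated), `U_injOn`; **`sum_Fib_eq_prod_K`**
  (for pairwise disjoint `𝒴`: the admissible families with unions exactly `𝒴` resum to `Π_{Y∈𝒴}K(Y)`); **`sum_admissible_eq_sum_famD`**: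
  `Σ_{𝒯 admissible} Π_{T∈𝒯} g(T) = Σ_{𝒴 ∈ famD} Π_{Y∈𝒴} K_g(Y)`.
* §4 THE PRINTED IDENTITY: **`mayer_expansion`**: `Π_{X∈Pol}(1 + a_X) = Σ_{{Y_j} ∈ famD} Π_j K(Y_j)` with `K(Y) = Σ_{{X_i}
  connected, ∪X_i = Y} Π_i a_{X_i}` (supports nonempty), and the exponential forms **`exp_sum_eq_mayer`** (ℝ) ∕
  **`cexp_sum_eq_mayer`** (ℂ): `exp(Σ_{X∈Pol}H(X)) = Σ_{{Y_j}} Π_j K(Y_j)` with `a_X = e^{H(X)} − 1`.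
* §5 (v1.1) STEPS 2–3, THE EXPONENTIATION (L3299–3304: *"Next we claim that Σ_{{Y_i}} Π_i K^#(Y_i) = exp(Σ_Y H^#(Y))
  where H^#(Y) = Σ_n (1/n!) Σ_{(Y_1,…,Y_n): ∪Y_i = Y} ρ^T(Y_1,…,Y_n) Π_i K^#(Y_i) and ρ^T(Y_1,…,Y_n) vanishes if the Y_j
  can be divided into disjoint sets. At first we demonstrate the identity as formal series. Afterwards we demonstrate
  convergence."*) OVER THE TREE'S ABSTRACT POLYMER GAS (`Literature.Probability.LatticeModels.PolymerGas` ∕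
  `ClusterExpansion`: hard-core partition function `Ξ`, Kotecký–Preiss logarithm, truncated functionals `Φ^T`, the
  PROVED Kotecký–Preiss theorem): `Inc` (*"ζ(X,Y) = 0 if X ∩ Y ≠ ∅"*, L3322–3324), `unions supp Pol` (the nonempty
  unions `Y`), **`mem_famD_iff_isCompatible`** (`famD` = the compatible sub-families), **`sum_famD_eq_polymerPartitionFunction`**
  (`Σ_{{Y_j}∈famD} Π_j K(Y_j) = Ξ_{unions}(K)`), **`cexp_sum_eq_polymerPartitionFunction`** (`exp(Σ_X H(X)) = Ξ_{unions}(K)`),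
  `Hsharp` (`H^#(Y)` := the sum of `Φ^T(𝒞)` over the sub-families `𝒞` of unions with `∪𝒞 = Y`),
  `sum_truncatedWeight_eq_sum_Hsharp`, **`polymerPartitionFunction_eq_cexp_sum_Hsharp`** (under the finite-volume KP
  condition on the activities: `Ξ_{unions}(w) = exp(Σ_Y H^#(Y))`), **`cexp_sum_eq_cexp_sum_Hsharp`** (steps 1–3 glued:
  `exp(Σ_X H(X)) = exp(Σ_Y H^#(Y))`), `truncatedWeight_unions_eq_zero` (*"ρ^T vanishes if the Y_j can be divided into
  disjoint sets"*: `Φ^T(𝒞) = 0` off clusters).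

**Readings (declared).**  (i) GENERALITY: any finite polymer set, supports in any cube type (the print: connected unions
of `M`-cubes on `𝕋`, `H(X,Φ)` at a fixed field `Φ`; connectedness of the `X` themselves is not needed for step 1 and
not assumed — `Y = ∪X_i` is then "connected" in the print's sense because the `X_i` are connected and overlap-linked;
the module's clusters are indexed by overlap-connected sub-collections, which is what *"cannot be divided into two
disjoint sets"* says).  (ii) *"collections of distinct polymers"* = `Finset`s of polymers (sets, no multiplicities, no
`1/n!` — the ordered form L3220–3225 is a rewriting not reproduced).  (iii) `famD` ranges over families of pairwise
DISJOINT nonempty unions drawn from the finitely many unions of sub-collections of `Pol`; for a `Y` that is not the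
union of a connected sub-collection `K(Y) = 0`, so the printed "sum over collections of disjoint polymers {Y_j}" and
the module's sum agree term by term where the print's terms are non-zero.  (iv) `K(∅)`: excluded by `famD`'s
nonemptiness clause (the empty FAMILY `{Y_j} = ∅` — *"(possibly empty)"* — is included and contributes `1`).  (v) (v1.1)
STEP 3 IN THE KOTECKÝ–PREISS FORM: Dimock proves the exponentiation as an identity of FORMAL SERIES over ordered tuples
with the Ursell coefficients `ρ^T` (eqs. (sunrise)–(midday2), Cayley's theorem in step 4) and then convergence from
(owl); the tree's abstract layer [KoteckyPreiss1986] defines `log Ξ` as the continuous branch and `Φ^T` by Möbius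
inversion over SETS of polymers, and PROVES `Ξ = exp(Σ_𝒞 Φ^T(𝒞))` under the finite-volume KP condition — the module
uses THAT theorem (a different, published road to the same identity; no formal series, no `ρ^T`, no Cayley), so
`Hsharp` is `H^#` regrouped from `Φ^T` (same fibres `∪𝒞 = Y`), and the smallness enters as the KP hypothesis `hKP` on
the activities of the gas of unions, NOT as Dimock's (owl) + `H_0 ≤ c_0`; deriving `hKP` from (owl)∕(sudsy)∕(ninety) is
step 4's business and is not done here.  (vi) The hard core `Inc Y Y′ := Y ∩ Y′ ≠ ∅ ∨ Y = Y′` is made reflexive also at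
`Y = ∅` (never a polymer of `unions`; compatibility compares distinct members only) because the KP layer asks
`[Std.Refl]`.

**What is NOT claimed.**  Step 2 (L3284–3297: the `dμ`-integration `K^#(Y) = ∫K(Y,Φ)dμ(Φ)` and *"fields at different
sites are independent random variables"* — a Fubini∕independence statement about the measure, not typed); the bound of
step 1 (L3234–3279; kernel in the sibling leaf `…Dimock2011to13.ClusterActivityBound`, by name — not imported); step 4
(L3399–3506: `|ρ^T| ≤` number of spanning trees, the tree-graph summation, Cayley's theorem, (sunshine0)) and hence the
KP hypothesis itself; THEOREM 27's statement as printed; analyticity in `Φ`; anything about `d_M`; anything of B1–B16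
(TEMPLATE.md §4.1 row «D1 §4.6» ↔ B12∕B13 cluster expansions — grade there; untouched).  NOT summit progress; NOT a
statement about any Bałaban paper; NOT continuum; NOT Clay.  v1: NEW leaf, imports Mathlib only; v1.1: + import
`Literature.Probability.LatticeModels.ClusterExpansion` (the tree's abstract polymer gas; no Summits import, no cycle)
and §5, append-only (every v1 declaration byte-identical); sub-namespace `…Dimock2011to13.MayerExpansion`; modifies
nothing.  Unit `b2b-balaban-template` gen 32 (journal CLAIMs D1-MAYER-KERNEL (v1), D1-MAYER-KP-BRIDGE (v1.1)); cell
records TEMPLATE.md §4.1 row «D1 §4.6», §4.3 row «D3 §3.1», §15.2; GAPS C-tmpl32-4, C-tmpl32-6.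
-/

noncomputable section

open Finset
open scoped BigOperators

namespace Literature.MathematicalPhysics.QuantumFieldTheory.Dimock2011to13.MayerExpansion

variable {P : Type*} [DecidableEq P]

/-! ## §1 Overlap-connectedness inside a collection -/

/-- `X`, `Y` are LINKED inside the collection `S`: joined by a chain of members of `S`, consecutive ones overlapping
(the relation whose classes are the groups of *"terms … grouped together"*, L3212–3214). [cite: Dimock2013, App. B Theorem cluster, proof step 1 (arXiv:1108.1335v2 TeX L3204–3225)] -/
def Linked (ov : P → P → Prop) (S : Finset P) : P → P → Prop :=
  Relation.ReflTransGen fun X Y => X ∈ S ∧ Y ∈ S ∧ ov X Y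

variable {ov : P → P → Prop}

omit [DecidableEq P] in
/-- every polymer is linked to itself. [cite: Dimock2013, App. B Theorem cluster, proof step 1 (arXiv:1108.1335v2 TeX L3204–3225)] -/
theorem Linked.rfl' {S : Finset P} {X : P} : Linked ov S X X := Relation.ReflTransGen.refl

omit [DecidableEq P] in
/-- chains concatenate. [cite: Dimock2013, App. B Theorem cluster, proof step 1 (arXiv:1108.1335v2 TeX L3204–3225)] -/
theorem Linked.trans' {S : Finset P} {X Y Z : P} (h1 : Linked ov S X Y) (h2 : Linked ov S Y Z) :
    Linked ov S X Z := Relation.ReflTransGen.trans h1 h2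

omit [DecidableEq P] in
/-- for a symmetric overlap relation, chains reverse. [cite: Dimock2013, App. B Theorem cluster, proof step 1 (arXiv:1108.1335v2 TeX L3204–3225)] -/
theorem Linked.symm' (hov : ∀ X Y, ov X Y → ov Y X) {S : Finset P} {X Y : P} (h : Linked ov S X Y) :
    Linked ov S Y X := by
  induction h with
  | refl => exact Relation.ReflTransGen.refl
  | tail _ hbc ih => exact Relation.ReflTransGen.head ⟨hbc.2.1, hbc.1, hov _ _ hbc.2.2⟩ ih

omit [DecidableEq P] in
/-- a chain from a member of `S` ends in `S`. [cite: Dimock2013, App. B Theorem cluster, proof step 1 (arXiv:1108.1335v2 TeX L3204–3225)] -/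
theorem Linked.mem_right {S : Finset P} {X Y : P} (h : Linked ov S X Y) (hX : X ∈ S) : Y ∈ S := by
  induction h with
  | refl => exact hX
  | tail _ hbc _ => exact hbc.2.1

omit [DecidableEq P] in
/-- chains survive enlarging the collection. [cite: Dimock2013, App. B Theorem cluster, proof step 1 (arXiv:1108.1335v2 TeX L3204–3225)] -/
theorem Linked.mono {S S' : Finset P} (hSS' : S ⊆ S') {X Y : P} (h : Linked ov S X Y) : Linked ov S' X Y := by
  induction h with
  | refl => exact Relation.ReflTransGen.refl
  | tail _ hbc ih => exact ih.tail ⟨hSS' hbc.1, hSS' hbc.2.1, hbc.2.2⟩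

omit [DecidableEq P] in
/-- one overlap is a chain. [cite: Dimock2013, App. B Theorem cluster, proof step 1 (arXiv:1108.1335v2 TeX L3204–3225)] -/
theorem Linked.single {S : Finset P} {X Y : P} (hX : X ∈ S) (hY : Y ∈ S) (h : ov X Y) : Linked ov S X Y :=
  Relation.ReflTransGen.single ⟨hX, hY, h⟩

/-- the overlap-component of `X` inside the collection `S` (the members of `S` linked to `X`). [cite: Dimock2013, App. B Theorem cluster, proof step 1 (arXiv:1108.1335v2 TeX L3204–3225)] -/
def comp (ov : P → P → Prop) (S : Finset P) (X : P) : Finset P := by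
  classical exact S.filter (Linked ov S X)

/-- the overlap-components of the collection `S` — the grouping of *"collections of distinct polymers {X_i}"* into
connected sub-collections (L3212–3214). [cite: Dimock2013, App. B Theorem cluster, proof step 1 (arXiv:1108.1335v2 TeX L3204–3225)] -/
def components (ov : P → P → Prop) (S : Finset P) : Finset (Finset P) := S.image (comp ov S)

/-- `S` is a CONNECTED collection: nonempty, and any two members are linked inside `S` — equivalently (for nonempty
`S`, `isConnColl_iff_noSplit`) Dimock's *"we require that the {X_i} cannot be divided into two disjoint sets"* (L3219).
[cite: Dimock2013, App. B Theorem cluster, proof step 1 (arXiv:1108.1335v2 TeX L3204–3225)] -/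
def IsConnColl (ov : P → P → Prop) (S : Finset P) : Prop := S.Nonempty ∧ ∀ X ∈ S, ∀ Y ∈ S, Linked ov S X Y

/-- `T`, `T'` are SEPARATED: no member of `T` overlaps a member of `T'` (so their unions are disjoint polymers,
`disjoint_U_iff`). [cite: Dimock2013, App. B Theorem cluster, proof step 1 (arXiv:1108.1335v2 TeX L3204–3225)] -/
def Separated (ov : P → P → Prop) (T T' : Finset P) : Prop := ∀ X ∈ T, ∀ Y ∈ T', ¬ ov X Y

omit [DecidableEq P] in
/-- membership in a component. [cite: Dimock2013, App. B Theorem cluster, proof step 1 (arXiv:1108.1335v2 TeX L3204–3225)] -/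
theorem mem_comp {S : Finset P} {X Y : P} : Y ∈ comp ov S X ↔ Y ∈ S ∧ Linked ov S X Y := by
  classical
  unfold comp
  simp [Finset.mem_filter]

omit [DecidableEq P] in
/-- components are sub-collections. [cite: Dimock2013, App. B Theorem cluster, proof step 1 (arXiv:1108.1335v2 TeX L3204–3225)] -/
theorem comp_subset (S : Finset P) (X : P) : comp ov S X ⊆ S := fun _ h => (mem_comp.1 h).1

omit [DecidableEq P] in
/-- `X` lies in its own component. [cite: Dimock2013, App. B Theorem cluster, proof step 1 (arXiv:1108.1335v2 TeX L3204–3225)] -/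
theorem mem_comp_self {S : Finset P} {X : P} (hX : X ∈ S) : X ∈ comp ov S X := mem_comp.2 ⟨hX, Linked.rfl'⟩

omit [DecidableEq P] in
/-- components of linked polymers coincide. [cite: Dimock2013, App. B Theorem cluster, proof step 1 (arXiv:1108.1335v2 TeX L3204–3225)] -/
theorem comp_eq_of_mem (hov : ∀ X Y, ov X Y → ov Y X) {S : Finset P} {X Y : P} (hY : Y ∈ comp ov S X) :
    comp ov S Y = comp ov S X := by
  obtain ⟨_, hXY⟩ := mem_comp.1 hY
  ext Z
  simp only [mem_comp]
  constructor
  · rintro ⟨hZ, hYZ⟩; exact ⟨hZ, hXY.trans' hYZ⟩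
  · rintro ⟨hZ, hXZ⟩; exact ⟨hZ, (hXY.symm' hov).trans' hXZ⟩

/-- membership in `components S`. [cite: Dimock2013, App. B Theorem cluster, proof step 1 (arXiv:1108.1335v2 TeX L3204–3225)] -/
theorem mem_components {S T : Finset P} : T ∈ components ov S ↔ ∃ X ∈ S, comp ov S X = T := by
  simp [components]

/-- the component of a member is a component. [cite: Dimock2013, App. B Theorem cluster, proof step 1 (arXiv:1108.1335v2 TeX L3204–3225)] -/
theorem comp_mem_components {S : Finset P} {X : P} (hX : X ∈ S) : comp ov S X ∈ components ov S :=
  mem_components.2 ⟨X, hX, rfl⟩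

/-- **the components exhaust `S`**: `⋃ (components S) = S`. [cite: Dimock2013, App. B Theorem cluster, proof step 1 (arXiv:1108.1335v2 TeX L3204–3225)] -/
theorem biUnion_components (S : Finset P) : (components ov S).biUnion id = S := by
  ext Y
  simp only [mem_biUnion, mem_components, id]
  constructor
  · rintro ⟨T, ⟨X, _, rfl⟩, hY⟩; exact comp_subset _ _ hY
  · intro hY; exact ⟨comp ov S Y, ⟨Y, hY, rfl⟩, mem_comp_self hY⟩

/-- components are sub-collections of `S`. [cite: Dimock2013, App. B Theorem cluster, proof step 1 (arXiv:1108.1335v2 TeX L3204–3225)] -/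
theorem subset_of_mem_components {S T : Finset P} (hT : T ∈ components ov S) : T ⊆ S := by
  obtain ⟨X, _, rfl⟩ := mem_components.1 hT; exact comp_subset _ _

/-- two components are disjoint or equal. [cite: Dimock2013, App. B Theorem cluster, proof step 1 (arXiv:1108.1335v2 TeX L3204–3225)] -/
theorem comp_disjoint_or_eq (hov : ∀ X Y, ov X Y → ov Y X) (S : Finset P) (X X' : P) :
    Disjoint (comp ov S X) (comp ov S X') ∨ comp ov S X = comp ov S X' := by
  by_cases h : Disjoint (comp ov S X) (comp ov S X')
  · exact Or.inl h
  · right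
    rw [Finset.not_disjoint_iff] at h
    obtain ⟨Y, h1, h2⟩ := h
    rw [← comp_eq_of_mem hov h1, comp_eq_of_mem hov h2]

/-- **the components are pairwise disjoint** (as sub-collections). [cite: Dimock2013, App. B Theorem cluster, proof step 1 (arXiv:1108.1335v2 TeX L3204–3225)] -/
theorem pairwiseDisjoint_components (hov : ∀ X Y, ov X Y → ov Y X) (S : Finset P) :
    ((components ov S : Finset (Finset P)) : Set (Finset P)).PairwiseDisjoint id := by
  intro T hT T' hT' hne
  obtain ⟨X, _, rfl⟩ := mem_components.1 (Finset.mem_coe.1 hT)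
  obtain ⟨X', _, rfl⟩ := mem_components.1 (Finset.mem_coe.1 hT')
  rcases comp_disjoint_or_eq hov S X X' with h | h
  · exact h
  · exact absurd h hne

omit [DecidableEq P] in
/-- a chain from `X` inside `S` stays inside the component of `X`. [cite: Dimock2013, App. B Theorem cluster, proof step 1 (arXiv:1108.1335v2 TeX L3204–3225)] -/
theorem Linked.in_comp {S : Finset P} {X Y : P} (h : Linked ov S X Y) : Linked ov (comp ov S X) X Y := by
  induction h with
  | refl => exact Linked.rfl'
  | tail hab hbc ih =>
    exact ih.tail ⟨mem_comp.2 ⟨hbc.1, hab⟩, mem_comp.2 ⟨hbc.2.1, hab.tail hbc⟩, hbc.2.2⟩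

omit [DecidableEq P] in
/-- **each component is a connected collection**. [cite: Dimock2013, App. B Theorem cluster, proof step 1 (arXiv:1108.1335v2 TeX L3204–3225)] -/
theorem isConnColl_comp (hov : ∀ X Y, ov X Y → ov Y X) {S : Finset P} {X : P} (hX : X ∈ S) :
    IsConnColl ov (comp ov S X) := by
  refine ⟨⟨X, mem_comp_self hX⟩, fun Y hY Z hZ => ?_⟩
  obtain ⟨_, hXY⟩ := mem_comp.1 hY
  obtain ⟨_, hXZ⟩ := mem_comp.1 hZ
  exact (hXY.in_comp.symm' hov).trans' hXZ.in_comp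

/-- each component is a connected collection. [cite: Dimock2013, App. B Theorem cluster, proof step 1 (arXiv:1108.1335v2 TeX L3204–3225)] -/
theorem isConnColl_of_mem_components (hov : ∀ X Y, ov X Y → ov Y X) {S T : Finset P} (hT : T ∈ components ov S) :
    IsConnColl ov T := by
  obtain ⟨X, hX, rfl⟩ := mem_components.1 hT; exact isConnColl_comp hov hX

/-- **DIMOCK'S FORMULATION OF CONNECTEDNESS**: a nonempty collection is connected iff it *"cannot be divided into two
disjoint sets"* (L3219) — every proper nonempty sub-collection has a member overlapping a member of its complement.
[cite: Dimock2013, App. B Theorem cluster, proof step 1 (arXiv:1108.1335v2 TeX L3215–3219)] -/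
theorem isConnColl_iff_noSplit {S : Finset P} (hS : S.Nonempty) :
    IsConnColl ov S ↔
      ∀ S₁ ⊆ S, S₁.Nonempty → S₁ ≠ S → ∃ X ∈ S₁, ∃ Y ∈ S \ S₁, ov X Y := by
  constructor
  · rintro ⟨_, hconn⟩ S₁ hS₁ hne₁ hneq
    obtain ⟨X, hX⟩ := hne₁
    have hY : ∃ Y ∈ S, Y ∉ S₁ := by
      by_contra h
      exact hneq (Finset.Subset.antisymm hS₁ fun Y hY => by
        by_contra hY1
        exact h ⟨Y, hY, hY1⟩)
    obtain ⟨Y, hYS, hYS₁⟩ := hY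
    have hXY := hconn X (hS₁ hX) Y hYS
    -- walk along the chain until it leaves S₁
    have key : ∀ Z, Linked ov S X Z → Z ∈ S₁ ∨ ∃ A ∈ S₁, ∃ B ∈ S \ S₁, ov A B := by
      intro Z hZ
      induction hZ with
      | refl => exact Or.inl hX
      | @tail b c _ hbc ih =>
        rcases ih with hb | hdone
        · by_cases hc : c ∈ S₁
          · exact Or.inl hc
          · exact Or.inr ⟨b, hb, c, Finset.mem_sdiff.2 ⟨hbc.2.1, hc⟩, hbc.2.2⟩
        · exact Or.inr hdone
    rcases key Y hXY with h | h
    · exact absurd h hYS₁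
    · exact h
  · intro h
    refine ⟨hS, fun X hX Y hY => ?_⟩
    -- the component of X cannot be a proper sub-collection
    have hcomp : comp ov S X = S := by
      by_contra hne
      obtain ⟨A, hA, B, hB, hAB⟩ := h (comp ov S X) (comp_subset S X) ⟨X, mem_comp_self hX⟩ hne
      obtain ⟨hBS, hBc⟩ := Finset.mem_sdiff.1 hB
      exact hBc (mem_comp.2 ⟨hBS, (mem_comp.1 hA).2.tail ⟨(mem_comp.1 hA).1, hBS, hAB⟩⟩)
    have hY' : Y ∈ comp ov S X := by rw [hcomp]; exact hY
    exact (mem_comp.1 hY').2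

/-- **distinct components are separated** (no overlaps across). [cite: Dimock2013, App. B Theorem cluster, proof step 1 (arXiv:1108.1335v2 TeX L3204–3225)] -/
theorem separated_of_mem_components (hov : ∀ X Y, ov X Y → ov Y X) {S T T' : Finset P} (hT : T ∈ components ov S)
    (hT' : T' ∈ components ov S) (hne : T ≠ T') : Separated ov T T' := by
  intro X hX Y hY hXY
  obtain ⟨X₀, _, rfl⟩ := mem_components.1 hT
  obtain ⟨Y₀, _, rfl⟩ := mem_components.1 hT'
  apply hne
  rw [← comp_eq_of_mem hov hX, ← comp_eq_of_mem hov hY]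
  refine (comp_eq_of_mem hov ?_).symm
  exact mem_comp.2 ⟨(mem_comp.1 hY).1, Linked.single (mem_comp.1 hX).1 (mem_comp.1 hY).1 hXY⟩

/-! ## §2 Admissible families and the regrouping -/

/-- the ADMISSIBLE families: finite families of pairwise separated, connected sub-collections of the polymer set `Pol`
(the index set of the regrouped sum, with clusters recorded as sub-collections). [cite: Dimock2013, App. B Theorem cluster, proof step 1 (arXiv:1108.1335v2 TeX L3204–3225)] -/
def admissible (ov : P → P → Prop) (Pol : Finset P) : Finset (Finset (Finset P)) := by
  classical
  exact Pol.powerset.powerset.filter fun 𝒯 =>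
    (∀ T ∈ 𝒯, IsConnColl ov T) ∧ ∀ T ∈ 𝒯, ∀ T' ∈ 𝒯, T ≠ T' → Separated ov T T'

/-- membership in the admissible families. [cite: Dimock2013, App. B Theorem cluster, proof step 1 (arXiv:1108.1335v2 TeX L3204–3225)] -/
theorem mem_admissible {Pol : Finset P} {𝒯 : Finset (Finset P)} :
    𝒯 ∈ admissible ov Pol ↔ (∀ T ∈ 𝒯, T ⊆ Pol) ∧ (∀ T ∈ 𝒯, IsConnColl ov T) ∧
      ∀ T ∈ 𝒯, ∀ T' ∈ 𝒯, T ≠ T' → Separated ov T T' := by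
  classical
  unfold admissible
  rw [Finset.mem_filter, Finset.mem_powerset]
  constructor
  · rintro ⟨h1, h2, h3⟩
    exact ⟨fun T hT => Finset.mem_powerset.1 (h1 hT), h2, h3⟩
  · rintro ⟨h1, h2, h3⟩
    exact ⟨fun T hT => Finset.mem_powerset.2 (h1 T hT), h2, h3⟩

/-- the components of any `S ⊆ Pol` form an admissible family. [cite: Dimock2013, App. B Theorem cluster, proof step 1 (arXiv:1108.1335v2 TeX L3204–3225)] -/
theorem components_mem_admissible (hov : ∀ X Y, ov X Y → ov Y X) {Pol S : Finset P} (hS : S ⊆ Pol) :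
    components ov S ∈ admissible ov Pol :=
  mem_admissible.2 ⟨fun _ hT => (subset_of_mem_components hT).trans hS,
    fun _ hT => isConnColl_of_mem_components hov hT,
    fun _ hT _ hT' hne => separated_of_mem_components hov hT hT' hne⟩

/-- in an admissible family, the component of any `X ∈ T ∈ 𝒯` inside `⋃𝒯` is `T` itself (separation stops every
chain at the boundary of `T`; connectedness of `T` gives the converse). [cite: Dimock2013, App. B Theorem cluster, proof step 1 (arXiv:1108.1335v2 TeX L3204–3225)] -/
theorem comp_biUnion_eq {Pol : Finset P} {𝒯 : Finset (Finset P)} (h𝒯 : 𝒯 ∈ admissible ov Pol) {T : Finset P}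
    (hT : T ∈ 𝒯) {X : P} (hX : X ∈ T) : comp ov (𝒯.biUnion id) X = T := by
  obtain ⟨_, hconn, hsep⟩ := mem_admissible.1 h𝒯
  have hTsub : T ⊆ 𝒯.biUnion id := Finset.subset_biUnion_of_mem id hT
  ext Y
  rw [mem_comp]
  constructor
  · rintro ⟨_, hXY⟩
    -- every member of the chain stays in T
    suffices h : ∀ Z, Linked ov (𝒯.biUnion id) X Z → Z ∈ T from h Y hXY
    intro Z hZ
    induction hZ with
    | refl => exact hX
    | tail _ hbc ih =>
      obtain ⟨_, hc, hovbc⟩ := hbc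
      obtain ⟨T', hT', hc'⟩ := Finset.mem_biUnion.1 hc
      by_cases hTT' : T = T'
      · subst hTT'; exact hc'
      · exact absurd hovbc (hsep T hT T' hT' hTT' _ ih _ hc')
  · intro hY
    exact ⟨hTsub hY, ((hconn T hT).2 X hX Y hY).mono hTsub⟩

/-- **the components of `⋃𝒯` are the members of `𝒯`** for admissible `𝒯` (the inverse direction of the bijection). [cite: Dimock2013, App. B Theorem cluster, proof step 1 (arXiv:1108.1335v2 TeX L3204–3225)] -/
theorem components_biUnion_of_admissible {Pol : Finset P} {𝒯 : Finset (Finset P)} (h𝒯 : 𝒯 ∈ admissible ov Pol) :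
    components ov (𝒯.biUnion id) = 𝒯 := by
  obtain ⟨_, hconn, _⟩ := mem_admissible.1 h𝒯
  ext T₀
  rw [mem_components]
  constructor
  · rintro ⟨X, hX, rfl⟩
    obtain ⟨T, hT, hXT⟩ := Finset.mem_biUnion.1 hX
    rw [comp_biUnion_eq h𝒯 hT hXT]; exact hT
  · intro hT₀
    obtain ⟨X, hX⟩ := (hconn T₀ hT₀).1
    exact ⟨X, Finset.mem_biUnion.2 ⟨T₀, hT₀, hX⟩, comp_biUnion_eq h𝒯 hT₀ hX⟩

/-- **THE REGROUPING** (L3212–3214 *"terms in this sum are grouped together into collections of disjoint polymers"*): a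
sum over ALL sub-collections `S ⊆ Pol` of a product over the components of `S` equals the sum over admissible families
of the product over their members — the map `S ↦ components S` is a bijection onto the admissible families with inverse
`𝒯 ↦ ⋃𝒯`. [cite: Dimock2013, App. B Theorem cluster, proof step 1 (arXiv:1108.1335v2 TeX L3204–3225)] -/
theorem sum_powerset_prod_components (hov : ∀ X Y, ov X Y → ov Y X) {R : Type*} [CommSemiring R] (Pol : Finset P)
    (g : Finset P → R) :
    ∑ S ∈ Pol.powerset, ∏ T ∈ components ov S, g T = ∑ 𝒯 ∈ admissible ov Pol, ∏ T ∈ 𝒯, g T := by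
  refine Finset.sum_nbij' (components ov) (fun 𝒯 => 𝒯.biUnion id) ?_ ?_ ?_ ?_ ?_
  · intro S hS; exact components_mem_admissible hov (Finset.mem_powerset.1 hS)
  · intro 𝒯 h𝒯
    exact Finset.mem_powerset.2 (Finset.biUnion_subset.2 fun T hT => (mem_admissible.1 h𝒯).1 T hT)
  · intro S _; exact biUnion_components S
  · intro 𝒯 h𝒯; exact components_biUnion_of_admissible h𝒯
  · intro S _; rfl

/-- a product over `S` splits over the components of `S` (`Finset.prod_biUnion`): `Π_{X∈S} a_X = Π_{T} Π_{X∈T} a_X`. [cite: Dimock2013, App. B Theorem cluster, proof step 1 (arXiv:1108.1335v2 TeX L3204–3225)] -/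
theorem prod_eq_prod_components (hov : ∀ X Y, ov X Y → ov Y X) {R : Type*} [CommMonoid R] (S : Finset P) (a : P → R) :
    ∏ X ∈ S, a X = ∏ T ∈ components ov S, ∏ X ∈ T, a X := by
  conv_lhs => rw [← biUnion_components (ov := ov) S]
  exact Finset.prod_biUnion (pairwiseDisjoint_components hov S)

/-- **MAYER EXPANSION, STEP 1 (clusters as sub-collections)**: `Π_X (1 + a_X) = Σ_{{X_i}} Π_i a_{X_i} = Σ_{admissible
𝒯} Π_{T∈𝒯} Π_{X∈T} a_X` — the first two printed lines (L3207–3208, `Finset.prod_one_add`) followed by the grouping into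
connected clusters. [cite: Dimock2013, App. B Theorem cluster, proof step 1 (arXiv:1108.1335v2 TeX L3204–3225)] -/
theorem prod_one_add_eq_sum_admissible (hov : ∀ X Y, ov X Y → ov Y X) {R : Type*} [CommSemiring R] (Pol : Finset P)
    (a : P → R) :
    ∏ X ∈ Pol, (1 + a X) = ∑ 𝒯 ∈ admissible ov Pol, ∏ T ∈ 𝒯, ∏ X ∈ T, a X := by
  rw [Finset.prod_one_add, ← sum_powerset_prod_components hov]
  exact Finset.sum_congr rfl fun S _ => prod_eq_prod_components hov S a


/-! ## §3 Grouping the clusters by their unions: Dimock's `K(Y)` -/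

section Unions

variable {C : Type*} [DecidableEq C]

/-- two polymers OVERLAP iff their supports (their sets of `M`-cubes) meet — the relation behind *"disjoint
polymers"* (L3213). [cite: Dimock2013, App. B Theorem cluster, proof step 1 (arXiv:1108.1335v2 TeX L3204–3225)] -/
def Overlap (supp : P → Finset C) : P → P → Prop := fun X Y => (supp X ∩ supp Y).Nonempty

omit [DecidableEq P] in
/-- overlap is symmetric. [cite: Dimock2013, App. B Theorem cluster, proof step 1 (arXiv:1108.1335v2 TeX L3204–3225)] -/
theorem overlap_symm (supp : P → Finset C) : ∀ X Y, Overlap supp X Y → Overlap supp Y X := by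
  intro X Y h; simpa [Overlap, Finset.inter_comm] using h

/-- the union `Y = ∪_i X_i` of a sub-collection, as a set of cubes (L3217 *"∪X_i = Y"*). [cite: Dimock2013, App. B Theorem cluster, proof step 1 (arXiv:1108.1335v2 TeX L3204–3225)] -/
def U (supp : P → Finset C) (T : Finset P) : Finset C := T.biUnion supp

/-- the CONNECTED COVERS of `Y`: sub-collections `{X_i} ⊆ Pol` with `∪X_i = Y` that *"cannot be divided into two
disjoint sets"* (L3217–3219) — the index set of `K(Y)`. [cite: Dimock2013, App. B Theorem cluster, proof step 1 (arXiv:1108.1335v2 TeX L3204–3225)] -/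
def covers (supp : P → Finset C) (Pol : Finset P) (Y : Finset C) : Finset (Finset P) := by
  classical exact Pol.powerset.filter fun T => IsConnColl (Overlap supp) T ∧ U supp T = Y

/-- **`K(Y) = Σ_{{X_i}: ∪X_i = Y} Π_i (e^{H(X_i)} − 1)`** (L3215–3219), here for a general cluster weight `g` (the print:
`g(T) = Π_{X∈T}(e^{H(X,Φ)} − 1)`). [cite: Dimock2013, App. B Theorem cluster, proof step 1 (arXiv:1108.1335v2 TeX L3204–3225)] -/
def K {R : Type*} [AddCommMonoid R] (supp : P → Finset C) (Pol : Finset P) (g : Finset P → R) (Y : Finset C) : R :=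
  ∑ T ∈ covers supp Pol Y, g T

/-- the admissible families whose members have unions exactly the polymers of `𝒴` (the fibre of `𝒯 ↦ {∪T : T ∈ 𝒯}`).
[cite: Dimock2013, App. B Theorem cluster, proof step 1 (arXiv:1108.1335v2 TeX L3204–3225)] -/
def Fib (supp : P → Finset C) (Pol : Finset P) (𝒴 : Finset (Finset C)) : Finset (Finset (Finset P)) :=
  (admissible (Overlap supp) Pol).filter fun 𝒯 => 𝒯.image (U supp) = 𝒴

/-- the *"collections of disjoint polymers {Y_j}"* (L3213): finite families of pairwise disjoint, nonempty unions of
sub-collections of `Pol` — the index set of the regrouped Mayer sum. [cite: Dimock2013, App. B Theorem cluster, proof step 1 (arXiv:1108.1335v2 TeX L3204–3225)] -/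
def famD (supp : P → Finset C) (Pol : Finset P) : Finset (Finset (Finset C)) :=
  ((Pol.powerset.image (U supp)).powerset).filter fun 𝒴 =>
    (∀ Y ∈ 𝒴, ∀ Y' ∈ 𝒴, Y ≠ Y' → Disjoint Y Y') ∧ ∀ Y ∈ 𝒴, Y.Nonempty

variable {supp : P → Finset C} {Pol : Finset P}

omit [DecidableEq P] in
/-- membership in the connected covers of `Y`. [cite: Dimock2013, App. B Theorem cluster, proof step 1 (arXiv:1108.1335v2 TeX L3204–3225)] -/
theorem mem_covers {Y : Finset C} {T : Finset P} :
    T ∈ covers supp Pol Y ↔ T ⊆ Pol ∧ IsConnColl (Overlap supp) T ∧ U supp T = Y := by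
  classical
  unfold covers; rw [Finset.mem_filter, Finset.mem_powerset]

/-- membership in the fibre over `𝒴`. [cite: Dimock2013, App. B Theorem cluster, proof step 1 (arXiv:1108.1335v2 TeX L3204–3225)] -/
theorem mem_Fib {𝒴 : Finset (Finset C)} {𝒯 : Finset (Finset P)} :
    𝒯 ∈ Fib supp Pol 𝒴 ↔ 𝒯 ∈ admissible (Overlap supp) Pol ∧ 𝒯.image (U supp) = 𝒴 := Finset.mem_filter

omit [DecidableEq P] in
/-- membership in the families of disjoint polymers. [cite: Dimock2013, App. B Theorem cluster, proof step 1 (arXiv:1108.1335v2 TeX L3204–3225)] -/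
theorem mem_famD {𝒴 : Finset (Finset C)} :
    𝒴 ∈ famD supp Pol ↔ (∀ Y ∈ 𝒴, Y ∈ Pol.powerset.image (U supp)) ∧
      (∀ Y ∈ 𝒴, ∀ Y' ∈ 𝒴, Y ≠ Y' → Disjoint Y Y') ∧ ∀ Y ∈ 𝒴, Y.Nonempty := by
  unfold famD; rw [Finset.mem_filter, Finset.mem_powerset]; rfl

omit [DecidableEq P] in
/-- unions of nonempty sub-collections of polymers with nonempty supports are nonempty. [cite: Dimock2013, App. B Theorem cluster, proof step 1 (arXiv:1108.1335v2 TeX L3204–3225)] -/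
theorem U_nonempty (hsupp : ∀ X, (supp X).Nonempty) {T : Finset P} (hT : T.Nonempty) : (U supp T).Nonempty := by
  obtain ⟨X, hX⟩ := hT
  obtain ⟨c, hc⟩ := hsupp X
  exact ⟨c, Finset.mem_biUnion.2 ⟨X, hX, hc⟩⟩

omit [DecidableEq P] in
/-- **the unions of two sub-collections are disjoint iff the sub-collections are separated**. [cite: Dimock2013, App. B Theorem cluster, proof step 1 (arXiv:1108.1335v2 TeX L3204–3225)] -/
theorem disjoint_U_iff {T T' : Finset P} : Disjoint (U supp T) (U supp T') ↔ Separated (Overlap supp) T T' := by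
  unfold U Separated Overlap
  rw [Finset.disjoint_biUnion_left]
  simp only [Finset.disjoint_biUnion_right, Finset.not_nonempty_iff_eq_empty, ← Finset.disjoint_iff_inter_eq_empty]

omit [DecidableEq P] in
/-- separated nonempty sub-collections have different (indeed disjoint) unions. [cite: Dimock2013, App. B Theorem cluster, proof step 1 (arXiv:1108.1335v2 TeX L3204–3225)] -/
theorem U_ne_of_separated (hsupp : ∀ X, (supp X).Nonempty) {T T' : Finset P} (hT : T.Nonempty)
    (hsep : Separated (Overlap supp) T T') : U supp T ≠ U supp T' := by
  intro h
  have hd : Disjoint (U supp T) (U supp T') := disjoint_U_iff.2 hsep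
  rw [← h, disjoint_self, Finset.bot_eq_empty] at hd
  exact (U_nonempty hsupp hT).ne_empty hd

/-- in an admissible family distinct members have distinct unions. [cite: Dimock2013, App. B Theorem cluster, proof step 1 (arXiv:1108.1335v2 TeX L3204–3225)] -/
theorem U_injOn (hsupp : ∀ X, (supp X).Nonempty) {𝒯 : Finset (Finset P)}
    (h𝒯 : 𝒯 ∈ admissible (Overlap supp) Pol) : Set.InjOn (U supp) 𝒯 := by
  intro T hT T' hT' h
  by_contra hne
  obtain ⟨_, hconn, hsep⟩ := mem_admissible.1 h𝒯
  exact U_ne_of_separated hsupp (hconn T hT).1 (hsep T hT T' hT' hne) h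

/-- sub-families of admissible families are admissible. [cite: Dimock2013, App. B Theorem cluster, proof step 1 (arXiv:1108.1335v2 TeX L3204–3225)] -/
theorem admissible_mono {𝒯 𝒯' : Finset (Finset P)} (h : 𝒯' ⊆ 𝒯) (h𝒯 : 𝒯 ∈ admissible ov Pol) :
    𝒯' ∈ admissible ov Pol := by
  obtain ⟨h1, h2, h3⟩ := mem_admissible.1 h𝒯
  exact mem_admissible.2 ⟨fun T hT => h1 T (h hT), fun T hT => h2 T (h hT),
    fun T hT T' hT' hne => h3 T (h hT) T' (h hT') hne⟩

/-- the member of the family `𝒯` whose union is `Y` (junk unless there is exactly one). [folklore] -/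
def theU (supp : P → Finset C) (𝒯 : Finset (Finset P)) (Y : Finset C) : Finset P :=
  (𝒯.filter fun T => U supp T = Y).biUnion id

/-- in an admissible family the member with a given union is recovered by `theU` (distinct members have distinct
unions). [cite: Dimock2013, App. B Theorem cluster, proof step 1 (arXiv:1108.1335v2 TeX L3204–3225)] -/
theorem theU_eq (hsupp : ∀ X, (supp X).Nonempty) {𝒯 : Finset (Finset P)} (h𝒯 : 𝒯 ∈ admissible (Overlap supp) Pol)
    {T₀ : Finset P} (hT₀ : T₀ ∈ 𝒯) {Y : Finset C} (hY : U supp T₀ = Y) : theU supp 𝒯 Y = T₀ := by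
  have hfilt : (𝒯.filter fun T => U supp T = Y) = {T₀} := by
    ext T
    simp only [Finset.mem_filter, Finset.mem_singleton]
    constructor
    · rintro ⟨hT, hTY⟩; exact U_injOn hsupp h𝒯 hT hT₀ (hTY.trans hY.symm)
    · rintro rfl; exact ⟨hT₀, hY⟩
  simp [theU, hfilt]

/-- the only admissible family with no unions is the empty family. [cite: Dimock2013, App. B Theorem cluster, proof step 1 (arXiv:1108.1335v2 TeX L3204–3225)] -/
theorem Fib_empty : Fib supp Pol ∅ = {∅} := by
  ext 𝒯
  rw [mem_Fib, Finset.mem_singleton, Finset.image_eq_empty]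
  constructor
  · rintro ⟨_, h⟩; exact h
  · rintro rfl; exact ⟨mem_admissible.2 ⟨by simp, by simp, by simp⟩, rfl⟩

/-- **THE FIBRE IDENTITY**: for pairwise disjoint `𝒴`, the admissible families whose unions are exactly `𝒴` resum to
`Π_{Y∈𝒴} K(Y)` — choosing such a family is choosing one connected cover per `Y ∈ 𝒴`, independently (disjointness of the
`Y`'s makes the chosen clusters automatically separated); by induction on `𝒴`, peeling off one polymer `Y₀` through
the bijection `𝒯 ↦ (T₀, 𝒯 ∖ {T₀})` with `∪T₀ = Y₀`. [cite: Dimock2013, App. B Theorem cluster, proof step 1 (arXiv:1108.1335v2 TeX L3204–3225)] -/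
theorem sum_Fib_eq_prod_K (hsupp : ∀ X, (supp X).Nonempty) {R : Type*} [CommSemiring R] (g : Finset P → R) :
    ∀ 𝒴 : Finset (Finset C), (∀ Y ∈ 𝒴, ∀ Y' ∈ 𝒴, Y ≠ Y' → Disjoint Y Y') →
      ∑ 𝒯 ∈ Fib supp Pol 𝒴, ∏ T ∈ 𝒯, g T = ∏ Y ∈ 𝒴, K supp Pol g Y := by
  intro 𝒴
  induction 𝒴 using Finset.induction_on with
  | empty => intro _; simp [Fib_empty]
  | insert Y₀ 𝒴 hY₀ ih =>
    intro hdisj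
    have hdisj' : ∀ Y ∈ 𝒴, ∀ Y' ∈ 𝒴, Y ≠ Y' → Disjoint Y Y' := fun Y hY Y' hY' hne =>
      hdisj Y (Finset.mem_insert_of_mem hY) Y' (Finset.mem_insert_of_mem hY') hne
    have hdisj0 : ∀ Y ∈ 𝒴, Disjoint Y₀ Y := fun Y hY =>
      hdisj Y₀ (Finset.mem_insert_self _ _) Y (Finset.mem_insert_of_mem hY) (fun h => hY₀ (h ▸ hY))
    have hins : ∀ p ∈ covers supp Pol Y₀ ×ˢ Fib supp Pol 𝒴, insert p.1 p.2 ∈ Fib supp Pol (insert Y₀ 𝒴) := by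
      rintro ⟨T₀, 𝒯'⟩ hp
      obtain ⟨hT₀, h𝒯'⟩ := Finset.mem_product.1 hp
      obtain ⟨hT₀sub, hT₀conn, hUT₀⟩ := mem_covers.1 hT₀
      obtain ⟨hadm', himg'⟩ := mem_Fib.1 h𝒯'
      obtain ⟨hsub', hconn', hsep'⟩ := mem_admissible.1 hadm'
      have hsep0 : ∀ T' ∈ 𝒯', Separated (Overlap supp) T₀ T' := by
        intro T' hT'
        have hUT' : U supp T' ∈ 𝒴 := himg' ▸ Finset.mem_image_of_mem _ hT'
        exact disjoint_U_iff.1 (hUT₀.symm ▸ hdisj0 _ hUT')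
      refine mem_Fib.2 ⟨mem_admissible.2 ⟨?_, ?_, ?_⟩, ?_⟩
      · intro T hT
        rcases Finset.mem_insert.1 hT with rfl | h
        · exact hT₀sub
        · exact hsub' T h
      · intro T hT
        rcases Finset.mem_insert.1 hT with rfl | h
        · exact hT₀conn
        · exact hconn' T h
      · intro T hT T' hT' hne
        rcases Finset.mem_insert.1 hT with rfl | h <;> rcases Finset.mem_insert.1 hT' with rfl | h'
        · exact absurd rfl hne
        · exact hsep0 T' h'
        · intro X hX Y hY hXY
          exact hsep0 T h Y hY X hX (overlap_symm supp _ _ hXY)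
        · exact hsep' T h T' h' hne
      · rw [Finset.image_insert, hUT₀, himg']
    -- the bijection  𝒯 ↦ (T₀, 𝒯 ∖ T₀)
    have hbij : ∑ 𝒯 ∈ Fib supp Pol (insert Y₀ 𝒴), ∏ T ∈ 𝒯, g T =
        ∑ p ∈ covers supp Pol Y₀ ×ˢ Fib supp Pol 𝒴, g p.1 * ∏ T ∈ p.2, g T := by
      refine Finset.sum_nbij' (fun 𝒯 => (theU supp 𝒯 Y₀, 𝒯.erase (theU supp 𝒯 Y₀)))
        (fun p => insert p.1 p.2) ?_ ?_ ?_ ?_ ?_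
      · -- into the product
        intro 𝒯 h𝒯
        obtain ⟨hadm, himg⟩ := mem_Fib.1 h𝒯
        obtain ⟨hsub, hconn, hsep⟩ := mem_admissible.1 hadm
        obtain ⟨T₀, hT₀, hUT₀⟩ := Finset.mem_image.1 (himg.symm ▸ Finset.mem_insert_self Y₀ 𝒴)
        rw [theU_eq hsupp hadm hT₀ hUT₀, Finset.mem_product]
        refine ⟨mem_covers.2 ⟨hsub T₀ hT₀, hconn T₀ hT₀, hUT₀⟩, mem_Fib.2 ⟨admissible_mono (Finset.erase_subset _ _) hadm, ?_⟩⟩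
        ext Y
        rw [Finset.mem_image]
        constructor
        · rintro ⟨T, hT, rfl⟩
          obtain ⟨hTne, hT𝒯⟩ := Finset.mem_erase.1 hT
          have hUT : U supp T ∈ insert Y₀ 𝒴 := himg ▸ Finset.mem_image_of_mem _ hT𝒯
          rcases Finset.mem_insert.1 hUT with h | h
          · exact absurd (U_injOn hsupp hadm hT𝒯 hT₀ (h.trans hUT₀.symm)) hTne
          · exact h
        · intro hY
          have hY' : Y ∈ insert Y₀ 𝒴 := Finset.mem_insert_of_mem hY
          rw [← himg, Finset.mem_image] at hY'
          obtain ⟨T, hT, hUT⟩ := hY'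
          refine ⟨T, Finset.mem_erase.2 ⟨?_, hT⟩, hUT⟩
          rintro rfl
          exact hY₀ ((hUT.symm.trans hUT₀).symm ▸ hY)
      · -- from the product
        intro p hp; exact hins p hp
      · -- left inverse
        intro 𝒯 h𝒯
        obtain ⟨hadm, himg⟩ := mem_Fib.1 h𝒯
        obtain ⟨T₀, hT₀, hUT₀⟩ := Finset.mem_image.1 (himg.symm ▸ Finset.mem_insert_self Y₀ 𝒴)
        simp only [theU_eq hsupp hadm hT₀ hUT₀]
        exact Finset.insert_erase hT₀
      · -- right inverse
        rintro ⟨T₀, 𝒯'⟩ hp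
        obtain ⟨hT₀, h𝒯'⟩ := Finset.mem_product.1 hp
        obtain ⟨_, _, hUT₀⟩ := mem_covers.1 hT₀
        obtain ⟨hadm', himg'⟩ := mem_Fib.1 h𝒯'
        have hT₀notin : T₀ ∉ 𝒯' := by
          intro h
          have : U supp T₀ ∈ 𝒴 := himg' ▸ Finset.mem_image_of_mem _ h
          exact hY₀ (hUT₀ ▸ this)
        -- the inserted family is admissible (proved in the second bullet); re-derive injectivity directly
        have hadm_ins : insert T₀ 𝒯' ∈ admissible (Overlap supp) Pol := (mem_Fib.1 (hins _ hp)).1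
        simp only [theU_eq hsupp hadm_ins (Finset.mem_insert_self T₀ 𝒯') hUT₀, Finset.erase_insert hT₀notin]
      · -- the summands agree
        intro 𝒯 h𝒯
        obtain ⟨hadm, himg⟩ := mem_Fib.1 h𝒯
        obtain ⟨T₀, hT₀, hUT₀⟩ := Finset.mem_image.1 (himg.symm ▸ Finset.mem_insert_self Y₀ 𝒴)
        simp only [theU_eq hsupp hadm hT₀ hUT₀]
        exact (Finset.mul_prod_erase 𝒯 g hT₀).symm
    rw [hbij, Finset.sum_product, Finset.prod_insert hY₀, ← ih hdisj', K, Finset.sum_mul_sum]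

/-- **THE REGROUPED SUM OVER DISJOINT POLYMERS**: `Σ_{𝒯 admissible} Π_{T∈𝒯} g(T) = Σ_{{Y_j} ∈ famD} Π_j K_g(Y_j)` — summing
first over the fibres of `𝒯 ↦ {∪T : T ∈ 𝒯}` (`Finset.sum_fiberwise_of_maps_to`) and evaluating each fibre by
`sum_Fib_eq_prod_K`. [cite: Dimock2013, App. B Theorem cluster, proof step 1 (arXiv:1108.1335v2 TeX L3204–3219)] -/
theorem sum_admissible_eq_sum_famD (hsupp : ∀ X, (supp X).Nonempty) {R : Type*} [CommSemiring R]
    (g : Finset P → R) :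
    ∑ 𝒯 ∈ admissible (Overlap supp) Pol, ∏ T ∈ 𝒯, g T = ∑ 𝒴 ∈ famD supp Pol, ∏ Y ∈ 𝒴, K supp Pol g Y := by
  have hmaps : ∀ 𝒯 ∈ admissible (Overlap supp) Pol, 𝒯.image (U supp) ∈ famD supp Pol := by
    intro 𝒯 h𝒯
    obtain ⟨hsub, hconn, hsep⟩ := mem_admissible.1 h𝒯
    refine mem_famD.2 ⟨?_, ?_, ?_⟩
    · intro Y hY
      obtain ⟨T, hT, rfl⟩ := Finset.mem_image.1 hY
      exact Finset.mem_image.2 ⟨T, Finset.mem_powerset.2 (hsub T hT), rfl⟩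
    · intro Y hY Y' hY' hne
      obtain ⟨T, hT, rfl⟩ := Finset.mem_image.1 hY
      obtain ⟨T', hT', rfl⟩ := Finset.mem_image.1 hY'
      have hTT' : T ≠ T' := fun h => hne (h ▸ rfl)
      exact disjoint_U_iff.2 (hsep T hT T' hT' hTT')
    · intro Y hY
      obtain ⟨T, hT, rfl⟩ := Finset.mem_image.1 hY
      exact U_nonempty hsupp (hconn T hT).1
  rw [← Finset.sum_fiberwise_of_maps_to hmaps]
  refine Finset.sum_congr rfl fun 𝒴 h𝒴 => ?_
  exact sum_Fib_eq_prod_K hsupp g 𝒴 (mem_famD.1 h𝒴).2.1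

/-! ## §4 The printed identity -/

/-- **MAYER EXPANSION, STEP 1, AS PRINTED**: `Π_X((a_X) + 1) = Σ_{{Y_j}} Π_j K(Y_j)` over the families of pairwise
disjoint polymers `{Y_j}`, with `K(Y) = Σ_{{X_i}: ∪X_i = Y, connected} Π_i a_{X_i}` (supports nonempty). [cite: Dimock2013,
App. B Theorem cluster, proof step 1 (arXiv:1108.1335v2 TeX L3204–3219)] -/
theorem mayer_expansion (hsupp : ∀ X, (supp X).Nonempty) {R : Type*} [CommSemiring R] (a : P → R) :
    ∏ X ∈ Pol, (1 + a X) = ∑ 𝒴 ∈ famD supp Pol, ∏ Y ∈ 𝒴, K supp Pol (fun T => ∏ X ∈ T, a X) Y :=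
  (prod_one_add_eq_sum_admissible (overlap_symm supp) Pol a).trans (sum_admissible_eq_sum_famD hsupp _)

/-- **`exp(Σ_X H(X)) = Σ_{{Y_j}} Π_j K(Y_j)`, `K(Y) = Σ_{{X_i}: ∪X_i = Y} Π_i(e^{H(X_i)} − 1)`** — real weights (the print at
a fixed real field `Φ` on the support of `μ`). [cite: Dimock2013, App. B Theorem cluster, proof step 1 (arXiv:1108.1335v2
TeX L3204–3219)] -/
theorem exp_sum_eq_mayer (hsupp : ∀ X, (supp X).Nonempty) (H : P → ℝ) :
    Real.exp (∑ X ∈ Pol, H X) =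
      ∑ 𝒴 ∈ famD supp Pol, ∏ Y ∈ 𝒴, K supp Pol (fun T => ∏ X ∈ T, (Real.exp (H X) - 1)) Y := by
  rw [Real.exp_sum, ← mayer_expansion hsupp]
  exact Finset.prod_congr rfl fun X _ => by ring

/-- the same with complex weights (*"H(X,Φ) … analytic"*; [Dimock2014] §3.1 L1425–1435 `exp(E* + R^#) = Π(𝓘(X) + 1) =
Σ_{{X_α}} Π 𝓘(X_α)`). [cite: Dimock2013, App. B Theorem cluster, proof step 1 (arXiv:1108.1335v2 TeX L3204–3219)] -/
theorem cexp_sum_eq_mayer (hsupp : ∀ X, (supp X).Nonempty) (H : P → ℂ) :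
    Complex.exp (∑ X ∈ Pol, H X) =
      ∑ 𝒴 ∈ famD supp Pol, ∏ Y ∈ 𝒴, K supp Pol (fun T => ∏ X ∈ T, (Complex.exp (H X) - 1)) Y := by
  rw [Complex.exp_sum, ← mayer_expansion hsupp]
  exact Finset.prod_congr rfl fun X _ => by ring

/-! ## §5 (v1.1) Steps 2–3: the regrouped sum is the partition function of a HARD-CORE POLYMER GAS of the unions
`Y`; exponentiation `Σ_{{Y_i}} Π K^#(Y_i) = exp(Σ_Y H^#(Y))` by the tree's Kotecký–Preiss theorem -/

open Literature.Probability.LatticeModels (IsCompatible polymerPartitionFunction polymerLogZ truncatedWeight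
  IsKPVolume IsPolymerCluster polymerLogZ_eq_sum_truncatedWeight exp_polymerLogZ_of_kp truncatedWeight_eq_zero_of_kp)

/-- Dimock's hard core between the regrouped polymers: `Y_i ∩ Y_j ≠ ∅` (step 3, L3322–3324: *"ζ(X,Y) = 1 if X ∩ Y = ∅
and ζ(X,Y) = 0 if X ∩ Y ≠ ∅"*), made reflexive on the empty set as well (`∨ Y = Y'`; immaterial for the gas, whose
compatibility only compares distinct members, and required by the abstract Kotecký–Preiss layer). [cite: Dimock2013,
App. B Theorem cluster, proof step 3 (arXiv:1108.1335v2 TeX L3316–3330)] -/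
def Inc : Finset C → Finset C → Prop := fun Y Y' => ¬ Disjoint Y Y' ∨ Y = Y'

/-- the hard core is decidable. [cite: Dimock2013, App. B Theorem cluster, proof step 3 (arXiv:1108.1335v2 TeX L3316–3330)] -/
instance : DecidableRel (Inc (C := C)) := fun Y Y' => by unfold Inc; infer_instance

/-- the hard core is reflexive (*"ζ(X,Y) = 0 if X ∩ Y ≠ ∅"*, and by fiat at `∅`). [cite: Dimock2013, App. B Theorem cluster,
proof step 3 (arXiv:1108.1335v2 TeX L3316–3330)] -/
instance : Std.Refl (Inc (C := C)) := ⟨fun _ => Or.inr rfl⟩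

/-- the hard core is symmetric. [cite: Dimock2013, App. B Theorem cluster, proof step 3 (arXiv:1108.1335v2 TeX L3316–3330)] -/
instance : Std.Symm (Inc (C := C)) :=
  ⟨fun _ _ h => h.elim (fun h => Or.inl fun h' => h h'.symm) fun h => Or.inr h.symm⟩

omit [DecidableEq P] in
/-- for distinct polymers, compatible = disjoint. [cite: Dimock2013, App. B Theorem cluster, proof step 3 (arXiv:1108.1335v2
TeX L3316–3330)] -/
theorem not_inc_iff {Y Y' : Finset C} (hne : Y ≠ Y') : ¬ Inc Y Y' ↔ Disjoint Y Y' := by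
  simp [Inc, hne]

/-- THE POLYMERS OF THE REGROUPED GAS: the nonempty unions `Y = ∪_i X_i` of sub-collections of `Pol` (the finite volume in
which the `{Y_j}` of L3213 live). [cite: Dimock2013, App. B Theorem cluster, proof step 1 (arXiv:1108.1335v2 TeX L3204–3225)] -/
def unions (supp : P → Finset C) (Pol : Finset P) : Finset (Finset C) :=
  (Pol.powerset.image (U supp)).filter fun Y => Y.Nonempty

omit [DecidableEq P] in
/-- `famD` = the compatible sub-families of `unions` for the hard core `Inc`. [cite: Dimock2013, App. B Theorem cluster,
proof steps 1, 3 (arXiv:1108.1335v2 TeX L3204–3225, L3316–3330)] -/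
theorem mem_famD_iff_isCompatible {𝒴 : Finset (Finset C)} :
    𝒴 ∈ famD supp Pol ↔ 𝒴 ⊆ unions supp Pol ∧ IsCompatible Inc 𝒴 := by
  rw [mem_famD]
  constructor
  · rintro ⟨hsub, hdisj, hne⟩
    refine ⟨fun Y hY => Finset.mem_filter.2 ⟨hsub Y hY, hne Y hY⟩, ?_⟩
    intro Y hY Y' hY' hYY'
    exact fun h => h.elim (fun h => h (hdisj Y hY Y' hY' hYY')) fun h => hYY' h
  · rintro ⟨hsub, hcomp⟩
    refine ⟨fun Y hY => (Finset.mem_filter.1 (hsub hY)).1, ?_, fun Y hY => (Finset.mem_filter.1 (hsub hY)).2⟩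
    intro Y hY Y' hY' hne
    exact (not_inc_iff hne).1 (hcomp hY hY' hne)

omit [DecidableEq P] in
/-- **STEP 1 ∘ STEP 3 (the regrouped sum IS a hard-core polymer partition function)**: `Σ_{{Y_j} ∈ famD} Π_j K(Y_j) =
Ξ_{unions}(K)`, the partition function (`Literature.Probability.LatticeModels.polymerPartitionFunction`) of the gas of
nonempty unions with activity `K` and incompatibility "intersect" — the object exponentiated in step 3 (L3299–3330: *"Σ_{{Y_i}}
Π_i K^#(Y_i) = 1 + Σ_n (1/n!) Σ_{(Y_1,…,Y_n): Y_i ∩ Y_j = ∅} Π K^#(Y_i)"*, here as a sum over SETS `{Y_i}`). [cite: Dimock2013,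
App. B Theorem cluster, proof steps 1–3 (arXiv:1108.1335v2 TeX L3204–3225, L3299–3330)] -/
theorem sum_famD_eq_polymerPartitionFunction (g : Finset P → ℂ) :
    ∑ 𝒴 ∈ famD supp Pol, ∏ Y ∈ 𝒴, K supp Pol g Y = polymerPartitionFunction Inc (K supp Pol g) (unions supp Pol) := by
  unfold polymerPartitionFunction
  rw [← Finset.sum_filter]
  refine Finset.sum_congr ?_ fun _ _ => rfl
  ext 𝒴
  rw [mem_famD_iff_isCompatible, Finset.mem_filter, Finset.mem_powerset]

/-- **`exp(Σ_X H(X)) = Ξ_{unions}(K)`**, `K(Y) = Σ_{{X_i}: ∪X_i = Y} Π(e^{H(X_i)} − 1)` — steps 1 and 3 glued: the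
exponential of the polymer sum is the partition function of the hard-core gas of the unions. [cite: Dimock2013, App. B
Theorem cluster, proof steps 1–3 (arXiv:1108.1335v2 TeX L3204–3225, L3299–3330)] -/
theorem cexp_sum_eq_polymerPartitionFunction (hsupp : ∀ X, (supp X).Nonempty) (H : P → ℂ) :
    Complex.exp (∑ X ∈ Pol, H X) =
      polymerPartitionFunction Inc (K supp Pol fun T => ∏ X ∈ T, (Complex.exp (H X) - 1)) (unions supp Pol) := by
  rw [cexp_sum_eq_mayer hsupp, sum_famD_eq_polymerPartitionFunction]

/-- **`H^#(Y)`** (L3308–3314: *"H^#(Y) = Σ_n (1/n!) Σ_{(Y_1,…,Y_n): ∪Y_i = Y} ρ^T(Y_1,…,Y_n) Π_i K^#(Y_i)"*), here in the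
Kotecký–Preiss form of the tree: the sum of the truncated functionals `Φ^T(𝒞)` (`…LatticeModels.truncatedWeight`, the
Möbius transform of the KP logarithm) over the sub-families `𝒞 ⊆ unions` with `∪𝒞 = Y` (reading (v) of the header).
[cite: Dimock2013, App. B Theorem cluster, proof step 3 eq. (hstar) (arXiv:1108.1335v2 TeX L3305–3315)] -/
def Hsharp (supp : P → Finset C) (Pol : Finset P) (w : Finset C → ℂ) (Y : Finset C) : ℂ :=
  ∑ 𝒞 ∈ (unions supp Pol).powerset with 𝒞.biUnion id = Y, truncatedWeight Inc w 𝒞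

omit [DecidableEq P] in
/-- regrouping the cluster sum by unions: `Σ_{𝒞 ⊆ unions} Φ^T(𝒞) = Σ_Y H^#(Y)`, `Y` over the unions of sub-families.
[cite: Dimock2013, App. B Theorem cluster, proof step 3 (arXiv:1108.1335v2 TeX L3299–3315, L3391–3394)] -/
theorem sum_truncatedWeight_eq_sum_Hsharp (w : Finset C → ℂ) :
    ∑ 𝒞 ∈ (unions supp Pol).powerset, truncatedWeight Inc w 𝒞 =
      ∑ Y ∈ (unions supp Pol).powerset.image (fun 𝒞 => 𝒞.biUnion id), Hsharp supp Pol w Y := by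
  rw [← Finset.sum_fiberwise_of_maps_to (g := fun 𝒞 : Finset (Finset C) => 𝒞.biUnion id)
    (t := (unions supp Pol).powerset.image fun 𝒞 => 𝒞.biUnion id) fun 𝒞 h𝒞 => Finset.mem_image_of_mem _ h𝒞]
  rfl

omit [DecidableEq P] in
/-- **STEP 3, EXPONENTIATION** (L3299–3304: *"Σ_{{Y_i}} Π_i K^#(Y_i) = exp(Σ_Y H^#(Y))"*; Dimock: *"At first we demonstrate
the identity as formal series. Afterwards we demonstrate convergence."*) — here AT ONCE in the convergent regime of the
tree's Kotecký–Preiss theorem (`…LatticeModels.exp_polymerLogZ_of_kp`, `polymerLogZ_eq_sum_truncatedWeight`): if the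
activities `w` (print: `K^#`) of the gas of unions satisfy the finite-volume KP condition with some size function `a`,
then `Ξ_{unions}(w) = exp(Σ_Y H^#(Y))`. [cite: Dimock2013, App. B Theorem cluster, proof step 3 (arXiv:1108.1335v2 TeX
L3299–3394)] -/
theorem polymerPartitionFunction_eq_cexp_sum_Hsharp {w : Finset C → ℂ} {a : Finset C → ℝ}
    (hKP : IsKPVolume Inc w a (unions supp Pol)) :
    polymerPartitionFunction Inc w (unions supp Pol) =
      Complex.exp (∑ Y ∈ (unions supp Pol).powerset.image (fun 𝒞 => 𝒞.biUnion id), Hsharp supp Pol w Y) := by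
  rw [← sum_truncatedWeight_eq_sum_Hsharp, ← polymerLogZ_eq_sum_truncatedWeight,
    exp_polymerLogZ_of_kp hKP subset_rfl]

/-- **STEPS 1–3 COMBINED** (the shape of THEOREM cluster's conclusion (sunshine), at a fixed field — i.e. without the
integration of step 2): `exp(Σ_X H(X)) = exp(Σ_Y H^#(Y))` whenever the regrouped activities `K` obey the KP condition.
[cite: Dimock2013, App. B Theorem cluster (arXiv:1108.1335v2 TeX L3178–3194, proof L3204–3394)] -/
theorem cexp_sum_eq_cexp_sum_Hsharp (hsupp : ∀ X, (supp X).Nonempty) (H : P → ℂ) {a : Finset C → ℝ}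
    (hKP : IsKPVolume Inc (K supp Pol fun T => ∏ X ∈ T, (Complex.exp (H X) - 1)) a (unions supp Pol)) :
    Complex.exp (∑ X ∈ Pol, H X) =
      Complex.exp (∑ Y ∈ (unions supp Pol).powerset.image (fun 𝒞 => 𝒞.biUnion id),
        Hsharp supp Pol (K supp Pol fun T => ∏ X ∈ T, (Complex.exp (H X) - 1)) Y) := by
  rw [cexp_sum_eq_polymerPartitionFunction hsupp, polymerPartitionFunction_eq_cexp_sum_Hsharp hKP]

omit [DecidableEq P] in
/-- *"ρ^T(Y_1,…,Y_n) vanishes if the Y_j can be divided into disjoint sets"* (L3315, L3353–3354) — in the KP form: the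
truncated functional of a sub-family `𝒞` of the gas of unions VANISHES unless `𝒞` is a cluster for "intersect" (not
decomposable into two mutually disjoint non-empty parts); the tree's `…LatticeModels.truncatedWeight_eq_zero_of_kp`.
[cite: Dimock2013, App. B Theorem cluster, proof step 3 (arXiv:1108.1335v2 TeX L3315, L3347–3354)] -/
theorem truncatedWeight_unions_eq_zero {w : Finset C → ℂ} {a : Finset C → ℝ}
    (hKP : IsKPVolume Inc w a (unions supp Pol)) {𝒞 : Finset (Finset C)} (h𝒞 : 𝒞 ⊆ unions supp Pol)
    (hsplit : ¬ IsPolymerCluster Inc 𝒞) : truncatedWeight Inc w 𝒞 = 0 :=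
  truncatedWeight_eq_zero_of_kp hKP h𝒞 hsplit

end Unions

end Literature.MathematicalPhysics.QuantumFieldTheory.Dimock2011to13.MayerExpansion

end
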